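import Summits.QuantumFields.BalabanUV.T4Continuum.Support.NE7ApeOfTorusRoadLetters
import Summits.QuantumFields.BalabanUV.T4Continuum.Support.NE7ApeTrivialFlatEndSkew
import Summits.QuantumFields.BalabanUV.T4Continuum.Support.NE7SliceGreenFlat
import HarnessLib

/-!
# NE7ApeOfTorusRoadOwned — THE TORUS-ROAD END (F246) WITH EVERY OWNED LETTER DISCHARGED BY NAME: the flat reference `F̃ := 1`, the slice solver G♭
# (`NE7SliceGreenFlat.sliceGreen_flat`, `K_G = K·M`), the normal part `A_N :=` the skew part of the flat Landau lift `R_H(D_1A)` — EXACT (F36), hess-ORTHOGONAL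
# (F40b), PERIODIC (F44), skew (p2's `NE7FlatSkewSlice`) — with its curl bounded EVERYWHERE by the COARSE CURL of the linearised top average `D_1A` ((R7♭), F37:
# `‖d_1A_N(p)‖ ≤ card n·C_H·ĝ∕M²`), and the flat expansion remainder EXP (F48b, `ρ = ρ(α₀, α₁)`); so `hape` (= [Balaban1985Variational] Prop. 8) ⇐ PER PLAQUETTE
# a chart `A` (sup `α₀`, lattice gradient `α₁`, coarse curl `ĝ`) matched to `U` on the plaquette by a gauge, critical up to an `(ℓ¹)*`-defect `τ` on flat tangents,
# and ONE numeric line `K·M·(τ + ρ(α₀,α₁)) + card n·C_H·ĝ∕M² + 28α₀² ≤ (c₀ + θr)∕M²`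

Cell `pub-balaban`, rung (B)+1 sub-cell t4, lineage `b2b-balaban-t4-ne7-p1` (CRUX PROVER NE7 #1 = OWNER of row NE7), generation 89; memo
`t4/b2b-balaban-t4-ne7-p1-g89/COSTING-N1.md` §1.  File F251 (over F246 `NE7ApeOfTorusRoadLetters.hape_of_torusRoadLetters`; G♭ `NE7SliceGreenFlat.sliceGreen_flat`
(p393256); F37 `NE7FlatHkCurlLetter.rightInverse_flat_curl_le`; F40b `NE7FlatHkOrthogonal.hess_flat_hkLift_eq_zero`; F44 `NE7FlatLiftBookkeeping.hkLift_periodic`;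
F48b `NE7ExpansionRemainderFlat.abs_dAction_vary_sub_hess_flat_le`; lineage p2's `NE7FlatSkewSlice` (skew part keeps EXACT ∕ NORTH ∕ CURL); row NE3's
`NE7TangentTransportGauge.dirIter_skew_periodic`, `NE3CpushGaugeCovariance.dirIter_succ_eq_cpushIter`) — the composition pattern of gen 72's F55a
`NE7ApeTrivialFlatEndSkew` (flat TOP) transposed to gen 88's LOCAL end (any top).

WHY.  F246 displayed the torus road's per-plaquette bundle `hltr` with TEN existential components, five of which are TREE THEOREMS of this lineage at the flat
reference (`F̃ = 1`, G♭, H♭'s exactness, (R⊥♭), periodicity) and one of which — the normal part's curl AT THE PLAQUETTE, for which gen 88 budgeted a DECAY ROW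
(N3) of `∇H♭` plus a local datum bound (N4) — is ALREADY OWNED GLOBALLY in a stronger currency: (R7♭) bounds the fine curl of the lift EVERYWHERE by the sup of
the COARSE CURL `ĝ` of its datum `D_1A` (not by the datum's size), uniformly in `k` and in the torus (gen 65's LIN-ONE-STEP, [Balaban1984PropagatorsI] `H_k`'s
minimum-curvature property).  For the cut-off chart `A = χ·A_loc` of the torus road, `D_1A` is supported near the cube and its coarse curl is the datum's
coarse plaquette radius `4(e^β − 1)` plus commutator (`R⁻¹`) and quadratic terms (memo §1) — NO kernel decay is needed.  THIS FILE therefore re-issues the END with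
those six components discharged BY NAME and EXP instantiated: what remains displayed is exactly what the two outstanding suppliers must deliver — (N1) the local
regular chart + cutoff (`A`, `α₀ ≲ Rr∕M`, `α₁ ≲ c′r∕M²`, `ĝ`) and (N2) the defect `τ` (F247–F250 + (N2)′(b)) — and the numeric line.
WHAT ([folklore] composition; 0 def, 0 sorry; dimension `d + 1 ≥ 2`, `L ≥ 2` as in G♭).
§1 `skewPart_normal_letters` — p2's R1b as one lemma: the skew part of a normal part keeps PERIODIC ∕ EXACT (against a skew `A`) ∕ NORTH ∕ CURL.
§2 **`exists_flat_normalPart`** — for every skew `(L^{k+1}N)`-periodic `A` whose linearised top average `D_1A := dirIter L (k+1) 1 A` has flat (coarse) curl `≤ ĝ`: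
   `∃ A_N` skew, periodic, EXACT (`D_1A_N = D_1A`), NORTH (`hess 1 A_N Y = 0` on skew periodic flat tangents `Y`), with `‖curlAt 1 A_N z μ ν‖ ≤ card n·(C_H∕M)·(ĝ∕M)`
   at EVERY `z, μ, ν` (`C_H = C_H(d)` = F37's constant, `M = L^{k+1}`).
§3 **`hape_of_torusRoadOwned`** — `∃ K ≥ 0` (G♭'s constant, on `d, L, card n` only) such that for every `N ≥ 1`, `c₀ ≥ 0`, `0 ≤ θ < 1`, `c₀ + θδ ≤ δ`,
   `δ₁ > c₀∕(1−θ)`: the per-plaquette REDUCED bundle (for every datum of `𝒟_β`, level `k+1`, admissible tangent-critical `U` with `SmallField U (r∕M²)`, `0 ≤ r ≤ δ`,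
   corner `z`, plane `μ ≠ ν`: `∃ A α₀ α₁ τ ĝ u` — `A` skew `(N·L^{k+1})`-periodic, `‖A‖ ≤ α₀`, `‖A(y+e_τ) − A(y)‖ ≤ α₁`, `‖curlAt 1 (D_1A)‖ ≤ ĝ`; the defect letter
   `|dAction (e^{A}) Y| ≤ τ‖Y‖₁` on skew periodic flat tangents; a unitary gauge `u` with `U^u = e^{A}` on the four bonds of the plaquette; the line
   `K·M·(τ + ρ(α₀,α₁)) + card n·(C_H∕M)·(ĝ∕M) + 28α₀² ≤ (c₀ + θr)∕M²`, `ρ(α₀,α₁)` = F48b's explicit density) ⟹ F31's `hape` for `δ₁`.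
HONEST FRAMING (page 1): composition BY NAME of tree theorems over F246; the reduced bundle is a HYPOTHESIS asserted for nothing — its suppliers (N1) (local regular
chart with `c′ = o(R)`, the analytic input; memo §2 prices it) and (N2) (the defect assembly) are NOT in the tree; nothing of Bałaban's asserted; NOT (APE), NOT
ONE-STEP, NOT NE7; spine 0∕9; finite T⁴ rung (B)+1 — NOT infinite volume, NOT mass gap, NOT `BetaPertH`, NOT Clay.  Continuum YM on T⁴ ⇐ BetaPertH ∧ nine spine
estimates (0/9 proved); BetaPertH ⇐ (D1) ∧ (D4) ∧ CAP+tail; G-an2-4 gates asym, D1 and NE2/3/4.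
-/

set_option autoImplicit false

open scoped BigOperators Matrix.Norms.L2Operator
open NormedSpace Finset Set

namespace Summit.QuantumFields.BalabanUV.T4Continuum.NE7ApeOfTorusRoadOwned

open Literature.MathematicalPhysics.QuantumFieldTheory.Balaban1983to89
open B7Prop1Explicit B7Prop2Explicit MatrixLog UnitaryModel
open T4AveragingDeficitWall (IsUnitaryCfg IsSkewDir SmallField vary curlAt dirL1 flat_mem_classes)
open T4AveragingDeficitWallBoundary (IsPeriodicCfg periodBox)
open AveragingDeficitPeriodicCounting (IsPeriodicDir)
open AveragingDeficitMultiLevelPrep (LevelSmall TangentIter tower)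
open AveragingDeficitMultiLevelBridge (tower_eq)
open MinimalActionLevels (perWin)
open MinimalActionSandwich (admissible)
open MinimalActionRate (sfClass)
open BlockAveragePushDirSplit (flat)
open B4Sect5Proof (latticeConst)
open B5Prop11Plancherel (Tor fine)
open B5Hk163Strip (kappa163)
open B5Hk163Torus (HkOp)
open B5Hk163TorusHolderDecay (CdecD)
open B6LowerBound2153Torus (toT)
open NE3HessForm (hess dAction)
open NE3TangentCovariantTower (dirIter)
open NE3EnergyShapes (IsUnitarySite)
open NE3CpushGaugeCovariance (dirIter_succ_eq_cpushIter)
open NE7FlatLiftBookkeeping (hkLift_periodic)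
open NE7FlatSkewSlice (skewPart isSkewDir_skewPart isPeriodicDir_skewPart skewPart_eq_self dirIter_flat_skewPart isSkewDir_dirIter_flat
  hess_flat_skewPart norm_curlAt_flat_skewPart_le)
open NE7FlatHkCurlLetter (rightInverse_flat_curl_le)
open NE7FlatHkOrthogonal (hess_flat_hkLift_eq_zero)
open NE7ExpansionRemainderFlat (abs_dAction_vary_sub_hess_flat_le)
open NE7TangentTransportGauge (dirIter_skew_periodic)
open NE7CoarseCurvatureLetter (levelSmall_zero)
open NE7SliceGreenFlat (sliceGreen_flat)
open NE7ApeOfTorusRoadLetters (hape_of_torusRoadLetters)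

noncomputable section

variable {d : ℕ} {n : Type*} [Fintype n] [DecidableEq n]

/-! ## §1 The skew part of a normal part keeps its four letters (lineage p2's R1b, packaged) -/

/-- **R1b AS ONE LEMMA**: at the flat background, if `A_N` is `P`-periodic, EXACT against a SKEW `A` (`D_1A_N = D_1A`, `D_1 = dirIter L (k+1) 1`), NORTH on skew
periodic flat tangents and has curl `≤ c_N` everywhere, then so does its skew part `½(A_N − A_Nᴴ)`, which is moreover skew
(`NE7FlatSkewSlice.dirIter_flat_skewPart ∕ hess_flat_skewPart ∕ norm_curlAt_flat_skewPart_le`). [folklore] -/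
theorem skewPart_normal_letters {L : ℕ} (hL : 1 ≤ L) (k : ℕ) {P : ℕ}
    {A AN : Site d → Fin d → Matrix n n ℂ} (hA : IsSkewDir A)
    (hNP : IsPeriodicDir AN (P : ℤ))
    (hNexact : dirIter L (k + 1) (flat (d := d) (n := n)) AN = dirIter L (k + 1) (flat (d := d) (n := n)) A)
    (hNorth : ∀ Y : Site d → Fin d → Matrix n n ℂ, IsSkewDir Y → IsPeriodicDir Y (P : ℤ) →
      dirIter L (k + 1) (flat (d := d) (n := n)) Y = 0 → hess (flat (d := d) (n := n)) AN Y (perWin d P) = 0)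
    {cN : ℝ} (hNcurl : ∀ (z : Site d) (μ ν : Fin d), ‖curlAt (flat (d := d) (n := n)) AN z μ ν‖ ≤ cN) :
    IsSkewDir (skewPart AN) ∧ IsPeriodicDir (skewPart AN) (P : ℤ) ∧
      dirIter L (k + 1) (flat (d := d) (n := n)) (skewPart AN) = dirIter L (k + 1) (flat (d := d) (n := n)) A ∧
      (∀ Y : Site d → Fin d → Matrix n n ℂ, IsSkewDir Y → IsPeriodicDir Y (P : ℤ) →
        dirIter L (k + 1) (flat (d := d) (n := n)) Y = 0 → hess (flat (d := d) (n := n)) (skewPart AN) Y (perWin d P) = 0) ∧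
      ∀ (z : Site d) (μ ν : Fin d), ‖curlAt (flat (d := d) (n := n)) (skewPart AN) z μ ν‖ ≤ cN := by
  refine ⟨isSkewDir_skewPart AN, isPeriodicDir_skewPart hNP, ?_, fun Y hY hYP hYT => ?_, fun z μ ν => ?_⟩
  · rw [dirIter_flat_skewPart hL, hNexact, skewPart_eq_self (isSkewDir_dirIter_flat hL (k + 1) hA)]
  · rw [hess_flat_skewPart AN hY]
    exact hNorth Y hY hYP hYT
  · exact (norm_curlAt_flat_skewPart_le AN z μ ν).trans (hNcurl z μ ν)

/-! ## §2 The flat normal part of ANY skew periodic field: skew, periodic, exact, north, with (R7♭)'s global curl bound -/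

/-- **THE FLAT NORMAL PART, OWNED** (dimension `d + 1`): for every skew `(L^{k+1}·N)`-periodic direction field `A` whose linearised top average
`D_1A = dirIter L (k+1) 1 A` (an `N`-periodic coarse field) has flat curl `≤ ĝ` at every coarse point and plane, there is `A_N` — the skew part of lit-balaban's
Landau lift `H_k` of `M⁻¹·D_1A` pulled back entrywise and corrected by row NE3's curl-free frame potential (F36) — which is skew, `(L^{k+1}·N)`-periodic, EXACT
(`D_1A_N = D_1A`), `hess`-ORTHOGONAL to every skew periodic flat tangent (F40b), and whose flat curl obeys, at EVERY fine point and plane,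
`‖curlAt 1 A_N z μ ν‖ ≤ card n·(C_H(d)∕M)·(ĝ∕M)` (F37, (R7♭): the lift's curvature is controlled by the COARSE CURVATURE of its datum — uniformly in `k` and `N`).
[folklore] -/
theorem exists_flat_normalPart [Nonempty n] {L : ℕ} (hL : 1 ≤ L) (k N : ℕ) [NeZero N]
    {A : Site (d + 1) → Fin (d + 1) → Matrix n n ℂ} (hA : IsSkewDir A) (hAP : IsPeriodicDir A ((L ^ (k + 1) * N : ℕ) : ℤ))
    {g : ℝ} (hg : ∀ (y : Site (d + 1)) (μ ν : Fin (d + 1)),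
      ‖curlAt (flat (d := d + 1) (n := n)) (dirIter L (k + 1) (flat (d := d + 1) (n := n)) A) y μ ν‖ ≤ g) :
    ∃ AN : Site (d + 1) → Fin (d + 1) → Matrix n n ℂ,
      IsSkewDir AN ∧ IsPeriodicDir AN ((L ^ (k + 1) * N : ℕ) : ℤ) ∧
      dirIter L (k + 1) (flat (d := d + 1) (n := n)) AN = dirIter L (k + 1) (flat (d := d + 1) (n := n)) A ∧
      (∀ Y : Site (d + 1) → Fin (d + 1) → Matrix n n ℂ, IsSkewDir Y → IsPeriodicDir Y ((L ^ (k + 1) * N : ℕ) : ℤ) →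
        dirIter L (k + 1) (flat (d := d + 1) (n := n)) Y = 0 →
        hess (flat (d := d + 1) (n := n)) AN Y (perWin (d + 1) (L ^ (k + 1) * N)) = 0) ∧
      ∀ (z : Site (d + 1)) (μ ν : Fin (d + 1)), ‖curlAt (flat (d := d + 1) (n := n)) AN z μ ν‖
        ≤ Fintype.card n * ((2 * (CdecD d * (((d : ℝ) + 1) * (2 * ((d : ℝ) + 1))
              * ((2 + 32 / (kappa163 (d + 1) / (d + 1)) ^ 2) * latticeConst (d + 1) (kappa163 (d + 1) / (d + 1) / 2)))))
              / ((L ^ (k + 1) : ℕ) : ℝ) * (g / ((L ^ (k + 1) : ℕ) : ℝ))) := by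
  classical
  haveI : NeZero (L ^ (k + 1)) := ⟨pow_ne_zero _ (by omega)⟩
  have hflatU : IsUnitaryCfg (flat (d := d + 1) (n := n)) := (flat_mem_classes (d := d + 1) (n := n) le_rfl).1
  have hflat0 : SmallField (flat (d := d + 1) (n := n)) 0 := (flat_mem_classes (d := d + 1) (n := n) le_rfl).2
  have htow : ((tower L N (k + 1) : ℕ) : ℤ) = ((L ^ (k + 1) * N : ℕ) : ℤ) := by rw [tower_eq, Nat.mul_comm]
  have hflatPt : IsPeriodicCfg (flat (d := d + 1) (n := n)) ((tower L N (k + 1) : ℕ) : ℤ) := fun _ _ _ => rfl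
  have hAPt : IsPeriodicDir A ((tower L N (k + 1) : ℕ) : ℤ) := by rw [htow]; exact hAP
  obtain ⟨-, hφP⟩ := dirIter_skew_periodic (M := N) hL k hflatU hflatPt le_rfl (levelSmall_zero L k) hflat0 hA hAPt
  -- the lift `R_H(M⁻¹·D_1A)` (F36∕F37): EXACT + the (R7♭) curl letter
  obtain ⟨hexact, hN7all⟩ := rightInverse_flat_curl_le (n := n) hL k N (dirIter L (k + 1) (flat (d := d + 1) (n := n)) A) hφP hg
  have hNexact := hexact
  rw [← dirIter_succ_eq_cpushIter L k] at hNexact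
  -- PERIODIC (F44)
  have hNP := hkLift_periodic (d := d + 1) (n := n) hL k N
    (fun p : Tor (fun _ : Fin (d + 1) => N) × Fin (d + 1) => (((L ^ (k + 1) : ℕ) : ℂ))⁻¹
      • dirIter L (k + 1) (flat (d := d + 1) (n := n)) A (B6LowerBound2153Torus.rep (fun _ : Fin (d + 1) => N) p.1) p.2)
  -- its skew part (§1), with NORTH by F40b
  obtain ⟨h1, h2, h3, h4, h5⟩ := skewPart_normal_letters (d := d + 1) (n := n) hL k hA hNP hNexact
    (fun Y hY hYP hYT => hess_flat_hkLift_eq_zero (d := d + 1) (n := n) hL k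
      (fun p : Tor (fun _ : Fin (d + 1) => N) × Fin (d + 1) => (((L ^ (k + 1) : ℕ) : ℂ))⁻¹
        • dirIter L (k + 1) (flat (d := d + 1) (n := n)) A (B6LowerBound2153Torus.rep (fun _ : Fin (d + 1) => N) p.1) p.2)
      hY hYP (by rw [dirIter_succ_eq_cpushIter] at hYT; exact hYT)) hN7all
  exact ⟨_, h1, h2, h3, h4, h5⟩

/-! ## §3 THE END of the torus road with the owned letters discharged -/

/-- **`hape` ⇐ THE REDUCED PER-PLAQUETTE BUNDLE OF THE TORUS ROAD** (statement in the module docstring §3).  `K` is G♭'s constant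
(`NE7SliceGreenFlat.sliceGreen_flat`: on `d, L, card n` only — BEFORE `N`, `k`, the datum and the configuration).  Proof: F246 `hape_of_torusRoadLetters` at
`F̃ := 1`, class radius `x := 0`, `A_N :=` §2's normal part, `S := univ`, `K_G := K·L^{k+1}` (G♭), `ρ :=` F48b's density (EXP), the numeric line of F246 from the
displayed one through §2's curl bound at the plaquette. [cite: Balaban1985Variational, Prop. 8 p.304] -/
theorem hape_of_torusRoadOwned [Nonempty n] (hd : 1 ≤ d) {L : ℕ} (hL : 2 ≤ L) :
    ∃ K : ℝ, 0 ≤ K ∧ ∀ (N : ℕ) [NeZero N] (ε δ δ₁ β c₀ θ : ℝ), 0 ≤ c₀ → 0 ≤ θ → θ < 1 → c₀ + θ * δ ≤ δ → c₀ / (1 - θ) < δ₁ →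
    (∀ D : Site (d + 1) → Fin (d + 1) → (Matrix n n ℂ)ˣ, IsUnitaryCfg D → IsPeriodicCfg D (N : ℤ) → SmallField D (4 * (Real.exp β - 1)) →
      ∀ (k : ℕ), ∀ U ∈ admissible (sfClass (d + 1) L N ε) L (k + 1) D,
      (∀ φ : Site (d + 1) → Fin (d + 1) → Matrix n n ℂ, IsSkewDir φ → IsPeriodicDir φ ((N * L ^ (k + 1) : ℕ) : ℤ) → TangentIter L k U φ →
        dAction U φ (perWin (d + 1) (N * L ^ (k + 1))) = 0) →
      ∀ r : ℝ, 0 ≤ r → r ≤ δ → SmallField U (r / ((L : ℝ) ^ (k + 1)) ^ 2) →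
      ∀ (z : Site (d + 1)) (μ ν : Fin (d + 1)), μ ≠ ν →
        ∃ (A : Site (d + 1) → Fin (d + 1) → Matrix n n ℂ) (α₀ α₁ τ g : ℝ) (u : Site (d + 1) → (Matrix n n ℂ)ˣ),
          -- the chart, cut off ((N1) + cutoff): skew, periodic, sup `α₀`, lattice gradient `α₁`, coarse curl `ĝ` of its linearised top average
          (IsSkewDir A ∧ IsPeriodicDir A ((N * L ^ (k + 1) : ℕ) : ℤ) ∧ 0 ≤ α₀ ∧ 0 ≤ α₁ ∧ (∀ y κ, ‖A y κ‖ ≤ α₀) ∧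
            (∀ (y : Site (d + 1)) (κ τ' : Fin (d + 1)), ‖A (y + e τ') κ - A y κ‖ ≤ α₁) ∧
            (∀ (y : Site (d + 1)) (μ' ν' : Fin (d + 1)),
              ‖curlAt (flat (d := d + 1) (n := n)) (dirIter L (k + 1) (flat (d := d + 1) (n := n)) A) y μ' ν'‖ ≤ g)) ∧
          -- the criticality defect of `e^{A}` on skew periodic flat tangents ((N2))
          (0 ≤ τ ∧ ∀ Y : Site (d + 1) → Fin (d + 1) → Matrix n n ℂ, IsSkewDir Y → IsPeriodicDir Y ((N * L ^ (k + 1) : ℕ) : ℤ) →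
            dirIter L (k + 1) (flat (d := d + 1) (n := n)) Y = 0 →
            |dAction (vary (flat (d := d + 1) (n := n)) A 1) Y (perWin (d + 1) (N * L ^ (k + 1)))|
              ≤ τ * dirL1 Y (periodBox (d := d + 1) (N * L ^ (k + 1)))) ∧
          -- the gauge matching `U` to `e^{A}` on the four bonds of the plaquette
          (IsUnitarySite u ∧ gaugeAct u U z μ = vary (flat (d := d + 1) (n := n)) A 1 z μ ∧
            gaugeAct u U (z + e μ) ν = vary (flat (d := d + 1) (n := n)) A 1 (z + e μ) ν ∧
            gaugeAct u U (z + e ν) μ = vary (flat (d := d + 1) (n := n)) A 1 (z + e ν) μ ∧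
            gaugeAct u U z ν = vary (flat (d := d + 1) (n := n)) A 1 z ν) ∧
          -- the numeric line (G♭'s `K·M`, EXP's `ρ(α₀,α₁)`, (R7♭)'s `card n·(C_H∕M)·(ĝ∕M)`)
          K * (L : ℝ) ^ (k + 1) * (τ + ((Fintype.card (T4AveragingDeficitWall.Plane (d + 1)) : ℝ)
              * (2 * (8 * α₀ * (2 * α₁ + 28 * α₀ ^ 2) + 6 * (Real.exp α₀ - 1) * (2 * α₁ + 24 * (Real.exp α₀ - 1) * α₀)
                  + (2 * α₁ + 24 * (Real.exp α₀ - 1) * α₀) * (2 * α₁ + 28 * α₀ ^ 2) + 960 * (Real.exp α₀ - 1) * α₀ ^ 2)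
                + 64 * α₀ * α₁)))
            + Fintype.card n * ((2 * (CdecD d * (((d : ℝ) + 1) * (2 * ((d : ℝ) + 1))
              * ((2 + 32 / (kappa163 (d + 1) / (d + 1)) ^ 2) * latticeConst (d + 1) (kappa163 (d + 1) / (d + 1) / 2)))))
              / ((L ^ (k + 1) : ℕ) : ℝ) * (g / ((L ^ (k + 1) : ℕ) : ℝ)))
            + 28 * α₀ ^ 2 ≤ (c₀ + θ * r) / ((L : ℝ) ^ (k + 1)) ^ 2) →
    ∀ D : Site (d + 1) → Fin (d + 1) → (Matrix n n ℂ)ˣ, IsUnitaryCfg D → IsPeriodicCfg D (N : ℤ) → SmallField D (4 * (Real.exp β - 1)) →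
      ∀ (k : ℕ), ∀ U ∈ admissible (sfClass (d + 1) L N ε) L (k + 1) D, SmallField U (δ / ((L : ℝ) ^ (k + 1)) ^ 2) →
      (∀ φ : Site (d + 1) → Fin (d + 1) → Matrix n n ℂ, IsSkewDir φ → IsPeriodicDir φ ((N * L ^ (k + 1) : ℕ) : ℤ) → TangentIter L k U φ →
        dAction U φ (perWin (d + 1) (N * L ^ (k + 1))) = 0) → SmallField U (δ₁ / ((L : ℝ) ^ (k + 1)) ^ 2) := by
  classical
  obtain ⟨K, hK0, hGK⟩ := sliceGreen_flat (n := n) hd hL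
  refine ⟨K, hK0, ?_⟩
  intro N _ ε δ δ₁ β c₀ θ hc₀ hθ0 hθ1 hcδ hδ₁ hloc
  have hL1 : 1 ≤ L := by omega
  refine hape_of_torusRoadLetters (d := d + 1) (n := n) hL1 hc₀ hθ0 hθ1 hcδ hδ₁ ?_
  intro D hDu hDP hDs k U hU hcrit r hr0 hrδ hUr z μ ν hμν
  obtain ⟨A, α₀, α₁, τ, g, u, ⟨hA, hAP, hα₀, hα₁, hAα, hA1, hg⟩, ⟨hτ, hcritD⟩, ⟨hu, h1, h2, h3, h4⟩, hnum⟩ :=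
    hloc D hDu hDP hDs k U hU hcrit r hr0 hrδ hUr z μ ν hμν
  haveI : NeZero (L ^ (k + 1)) := ⟨pow_ne_zero _ (by omega)⟩
  have hmc : N * L ^ (k + 1) = L ^ (k + 1) * N := Nat.mul_comm _ _
  have hP1 : 1 ≤ N * L ^ (k + 1) := Nat.one_le_iff_ne_zero.mpr (Nat.mul_ne_zero (NeZero.ne N) (pow_ne_zero _ (by omega)))
  have hAP' : IsPeriodicDir A ((L ^ (k + 1) * N : ℕ) : ℤ) := by rw [← hmc]; exact hAP
  obtain ⟨AN, hNs, hNP, hNexact, hNorth, hNcurl⟩ := exists_flat_normalPart (n := n) hL1 k N hA hAP' hg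
  have hflatU : IsUnitaryCfg (flat (d := d + 1) (n := n)) := (flat_mem_classes (d := d + 1) (n := n) le_rfl).1
  have hflat0 : SmallField (flat (d := d + 1) (n := n)) 0 := (flat_mem_classes (d := d + 1) (n := n) le_rfl).2
  have hδe : 0 ≤ Real.exp α₀ - 1 := by linarith [Real.add_one_le_exp α₀]
  have hρ0 : 0 ≤ (Fintype.card (T4AveragingDeficitWall.Plane (d + 1)) : ℝ)
      * (2 * (8 * α₀ * (2 * α₁ + 28 * α₀ ^ 2) + 6 * (Real.exp α₀ - 1) * (2 * α₁ + 24 * (Real.exp α₀ - 1) * α₀)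
          + (2 * α₁ + 24 * (Real.exp α₀ - 1) * α₀) * (2 * α₁ + 28 * α₀ ^ 2) + 960 * (Real.exp α₀ - 1) * α₀ ^ 2)
        + 64 * α₀ * α₁) := by positivity
  refine ⟨flat, 0, A, AN, Set.univ, K * (L : ℝ) ^ (k + 1), _, τ, α₀, u, ⟨hflatU, hflat0, le_rfl, levelSmall_zero L k, hflat0⟩, ⟨hA, hAP, hAα⟩,
    ⟨hNs, by rw [hmc]; exact hNP, hNexact, fun Y hY hYP hYT => ?_⟩, ⟨Set.mem_univ _, fun X _ hXs hXP hXT g' hg' hsrc z' μ' ν' _ => ?_⟩,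
    ⟨hρ0, fun Y hY hYP => abs_dAction_vary_sub_hess_flat_le hP1 hA hAP hα₀ hα₁ hAα hA1 hY hYP⟩, ⟨hτ, hcritD⟩, ⟨hu, h1, h2, h3, h4⟩, ?_⟩
  · -- NORTH, period spelled `N·L^{k+1}`
    rw [hmc] at hYP ⊢
    exact hNorth Y hY hYP hYT
  · -- G♭
    rw [hmc] at hXP hsrc
    exact hGK k N X hXs hXP hXT g' hg' hsrc z' μ' ν'
  · -- the numeric line of F246 from the displayed one, through (R7♭) at the plaquette
    have hc := hNcurl z μ ν
    linarith

end

end Summit.QuantumFields.BalabanUV.T4Continuum.NE7ApeOfTorusRoadOwned
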